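import Summits.Parity.GeneralizedHardyLittlewood.Theorems.PrimeLevelFamEdgeMomentsBeyondDiagonalDiagCornerAbelBV
import Mathlib.NumberTheory.Harmonic.Bounds
import HarnessLib

/-!
# Route `PrimeLevelFamEdge`, crux K_A `MomentsBeyondDiagonal` (stmt-Parity-20007), line «petersson_layers» v4, stub `stub_diag`:
# **ray variation of a weight that is `1/y`-Lipschitz on `[1, ∞)`**

Companion to `…DiagCornerAbelBV.sum_abs_sub_le_of_lipschitz_sqrt` (the `(0,1]` regime). On `[1,∞)` the Bose coefficients
and the polynomial parts of `…DiagBoseMixedStructure` vary like `|r(y₁) − r(y₂)| ≤ K(y₂−y₁)/y₁` up to logarithms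
(`…DiagBoseMixedTail.abs_bose_coeff_sub_le_of_one_le`); along an arithmetic ray this gives a harmonic sum:

* `sum_Ioc_inv_le` — `Σ_{u<e≤w} 1/e ≤ 1 + log w` (`harmonic_le_one_add_log`);
* `sum_abs_sub_le_of_lipschitz_inv` — if `|r(y₁) − r(y₂)| ≤ K(y₂−y₁)/y₁` for `1 ≤ y₁ ≤ y₂ ≤ M`, then for `c > 0`,
  `c(u+1) ≥ 1`, `c(w+1) ≤ M`: `Σ_{u<e≤w}|r(c(e+1)) − r(ce)| ≤ K(1 + log w)`.

These feed the constants `V` (rows `k₁ > K₁`) of `…DiagCornerAbelBVTwoVar.abs_doubleSum_bv_pow_le`.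

Def-free; theorems only. Helper `--supports stmt-Parity-20007`; closes nothing; K_A, K_B and the Parity summit are NOT
proved; nothing about Landau–Siegel zeros.

## References
* E. Kowalski, P. Michel, J. VanderKam, J. reine angew. Math. 526 (2000), Prop. 5.1 p. 18.
  [cite: KowalskiMichelVanderKam2000, Prop. 5.1 — derivation (summation by parts in the corner of the diagonal)]
-/

noncomputable section

open Finset Real

namespace Summit.Parity.GeneralizedHardyLittlewood.Theorems.MomentsBeyondDiagonal.DiagCorner

/-- `Σ_{u<e≤w} 1/e ≤ 1 + log w`. [folklore] -/
theorem sum_Ioc_inv_le (u w : ℕ) : ∑ e ∈ Ioc u w, (1 : ℝ) / e ≤ 1 + Real.log w := by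
  have hsub : Ioc u w ⊆ Icc 1 w := by
    intro e he
    simp only [Finset.mem_Ioc, Finset.mem_Icc] at he ⊢
    omega
  have h1 : ∑ e ∈ Ioc u w, (1 : ℝ) / e ≤ ∑ e ∈ Icc 1 w, (1 : ℝ) / e :=
    Finset.sum_le_sum_of_subset_of_nonneg hsub fun e _ _ ↦ by positivity
  have h2 : ∑ e ∈ Icc 1 w, (1 : ℝ) / e = ((harmonic w : ℚ) : ℝ) := by
    rw [harmonic_eq_sum_Icc]
    push_cast
    refine Finset.sum_congr rfl fun e _ ↦ ?_
    rw [one_div]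
  have h3 := harmonic_le_one_add_log w
  linarith [h1, h2.le, h2.ge]

/-- **Ray variation of a `1/y`-Lipschitz weight.** If `|r(y₁) − r(y₂)| ≤ K(y₂−y₁)/y₁` for `1 ≤ y₁ ≤ y₂ ≤ M` (`K ≥ 0`), then
for `c > 0`, `1 ≤ c(u+1)`, `c(w+1) ≤ M`: `Σ_{u<e≤w} |r(c(e+1)) − r(ce)| ≤ K(1 + log w)`. [folklore] -/
theorem sum_abs_sub_le_of_lipschitz_inv {r : ℝ → ℝ} {K c M : ℝ} (hK : 0 ≤ K) (hc : 0 < c)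
    (hr : ∀ y₁ y₂ : ℝ, 1 ≤ y₁ → y₁ ≤ y₂ → y₂ ≤ M → |r y₁ - r y₂| ≤ K * (y₂ - y₁) / y₁)
    {u w : ℕ} (hu : 1 ≤ c * ((u : ℝ) + 1)) (hw : c * ((w : ℝ) + 1) ≤ M) :
    ∑ e ∈ Ioc u w, |r (c * ((e : ℝ) + 1)) - r (c * e)| ≤ K * (1 + Real.log w) := by
  have hterm : ∀ e ∈ Ioc u w, |r (c * ((e : ℝ) + 1)) - r (c * e)| ≤ K * ((1 : ℝ) / e) := by
    intro e he
    have he' := Finset.mem_Ioc.1 he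
    have heu : (u : ℝ) + 1 ≤ e := by exact_mod_cast (show u + 1 ≤ e by omega)
    have hew : (e : ℝ) + 1 ≤ (w : ℝ) + 1 := by exact_mod_cast (show e + 1 ≤ w + 1 by omega)
    have he0 : (0 : ℝ) < e := by exact_mod_cast (show 0 < e by omega)
    have hy1 : 1 ≤ c * (e : ℝ) := hu.trans (by nlinarith)
    have hy12 : c * (e : ℝ) ≤ c * ((e : ℝ) + 1) := by nlinarith
    have hy2 : c * ((e : ℝ) + 1) ≤ M := (by nlinarith : c * ((e : ℝ) + 1) ≤ c * ((w : ℝ) + 1)).trans hw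
    have h := hr (c * e) (c * ((e : ℝ) + 1)) hy1 hy12 hy2
    rw [abs_sub_comm] at h
    refine h.trans (le_of_eq ?_)
    field_simp
    ring
  calc ∑ e ∈ Ioc u w, |r (c * ((e : ℝ) + 1)) - r (c * e)| ≤ ∑ e ∈ Ioc u w, K * ((1 : ℝ) / e) :=
        Finset.sum_le_sum hterm
    _ = K * ∑ e ∈ Ioc u w, (1 : ℝ) / e := by rw [Finset.mul_sum]
    _ ≤ K * (1 + Real.log w) := mul_le_mul_of_nonneg_left (sum_Ioc_inv_le u w) hK

end Summit.Parity.GeneralizedHardyLittlewood.Theorems.MomentsBeyondDiagonal.DiagCorner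

end
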